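/-
Origin: expansion seat `planner-pub-hodgecm-pv06-g4-0`, handover #1 2026-08-18T08:22:14Z (`HOME/pub-hodgecm-pv06-g4/lean/Pv06g4/GLProd.lean`, md5 fa57c31f, 274 lines);
landed by the gen-7 packager in gate run 26 as `HodgeCM/PerL34/GLProd.lean` (verbatim).
-/
/-
Copyright: pub-hodgecm formalisation cell (harness21, 2026). New file (not vendored).
Origin: seat pub-hodgecm-pv06-g4 (WIP module `Pv06g4.GLProd`); intended final place
`HodgeCM/PerL34/GLProd.lean` (packager renames; no `HodgeCM.*` import is seat-local).
-/
import Summits.HodgeConjecture.HodgeCM.Vendored.Hermitian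
import Mathlib.Topology.Instances.Matrix
import Mathlib.Topology.Algebra.Group.Basic
import Mathlib.Topology.Algebra.Group.Units
import Mathlib.Topology.Algebra.ContinuousMonoidHom

/-!
# `GL_n` and unitary groups over a product of rings

KERNEL, hypothesis-free, generic linear algebra (Mathlib + the vendored `unitaryGroup σ H` only).
For (topological) commutative rings `R`, `S`:

* `matrixProd n R S : Matrix n n (R × S) ≃+* Matrix n n R × Matrix n n S` (entrywise), bicontinuous
  (`continuous_matrixProd`, `continuous_matrixProd_symm`), packaged as `matrixProdCME : _ ≃ₜ* _`;
* `glProdEquiv n R S : GL n (R × S) ≃ₜ* GL n R × GL n S` (continuous group isomorphism);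
* for an endomorphism `σ` of `R × S` acting componentwise through `σ₁`, `σ₂`
  (`h₁ : ∀ a, (σ a).1 = σ₁ a.1`, `h₂ : ∀ a, (σ a).2 = σ₂ a.2`) and `H ∈ M_n(R × S)`:
  `mem_unitaryGroup_prod_iff` — `g ∈ U_σ(H)` iff its two components lie in `U_{σ₁}(H₁)`, `U_{σ₂}(H₂)`
  (`Hᵢ` the component matrices) — and the continuous group isomorphism
  `unitaryProdEquiv h₁ h₂ H : unitaryGroup σ H ≃ₜ* unitaryGroup σ₁ (H.map Prod.fst) × unitaryGroup σ₂ (H.map Prod.snd)`;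
* `commute_of_prod_decomp`: in any group identified with a product, an element with trivial first component
  commutes with an element with trivial second component.

Used with `R × S = L_∞ × 𝔸_{L,f} = 𝔸_L` (Mathlib's `AdeleRing (𝓞 L) L` IS this product) and `σ = c ⊗ id` in
`HodgeCM.PerL34.AdelicUnitaryFactorisation` (node N23c, the D3 dictionary `U(H)(𝔸_{L⁺}) ≅ U(H)_∞ × U(H)(𝔸_{L⁺,f})`).
-/

set_option autoImplicit false

namespace HodgeCM.PerL34.GLProd

open Literature.AlgebraicGeometry.ShimuraVarieties (unitaryGroup)
open scoped Matrix

/-! ## §1 Matrices over a product ring -/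

section MatrixProd

variable (n : Type*) [Fintype n] (R S : Type*) [NonAssocSemiring R] [NonAssocSemiring S]

/-- `M_n(R × S) ≃+* M_n(R) × M_n(S)`, entrywise `(a_{ij}, b_{ij})_{ij} ↦ ((a_{ij}), (b_{ij}))`. -/
def matrixProd : Matrix n n (R × S) ≃+* Matrix n n R × Matrix n n S where
  toFun M := (M.map Prod.fst, M.map Prod.snd)
  invFun p := Matrix.of fun i j => (p.1 i j, p.2 i j)
  left_inv M := by
    ext i j <;> rfl
  right_inv p := by
    ext i j <;> rfl
  map_mul' M N :=
    Prod.ext (Matrix.map_mul (f := RingHom.fst R S)) (Matrix.map_mul (f := RingHom.snd R S))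
  map_add' M N := Prod.ext (Matrix.map_add Prod.fst (fun _ _ => rfl) M N)
    (Matrix.map_add Prod.snd (fun _ _ => rfl) M N)

/-- (Ported verbatim from the HodgeCMPerL package; no docstring in the source.) -/
@[simp] theorem matrixProd_apply_fst (M : Matrix n n (R × S)) : (matrixProd n R S M).1 = M.map Prod.fst := rfl

/-- (Ported verbatim from the HodgeCMPerL package; no docstring in the source.) -/
@[simp] theorem matrixProd_apply_snd (M : Matrix n n (R × S)) : (matrixProd n R S M).2 = M.map Prod.snd := rfl

/-- (Ported verbatim from the HodgeCMPerL package; no docstring in the source.) -/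
@[simp] theorem matrixProd_symm_apply (p : Matrix n n R × Matrix n n S) (i j : n) :
    (matrixProd n R S).symm p i j = (p.1 i j, p.2 i j) := rfl

/-- Two matrices over `R × S` agree iff their component matrices agree. -/
theorem ext_iff_map_fst_snd {M N : Matrix n n (R × S)} :
    M = N ↔ M.map Prod.fst = N.map Prod.fst ∧ M.map Prod.snd = N.map Prod.snd := by
  rw [← Prod.mk.injEq, ← (matrixProd n R S).injective.eq_iff]
  rfl

variable [TopologicalSpace R] [TopologicalSpace S]

/-- (Ported verbatim from the HodgeCMPerL package; no docstring in the source.) -/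
theorem continuous_matrixProd : Continuous (matrixProd n R S) :=
  (continuous_id.matrix_map continuous_fst).prodMk (continuous_id.matrix_map continuous_snd)

/-- (Ported verbatim from the HodgeCMPerL package; no docstring in the source.) -/
theorem continuous_matrixProd_symm : Continuous (matrixProd n R S).symm :=
  continuous_matrix fun i j =>
    (((continuous_apply j).comp ((continuous_apply i).comp continuous_fst)).prodMk
      ((continuous_apply j).comp ((continuous_apply i).comp continuous_snd)))

/-- `matrixProd` as a continuous multiplicative isomorphism. -/
def matrixProdCME : Matrix n n (R × S) ≃ₜ* Matrix n n R × Matrix n n S :=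
  { (matrixProd n R S).toMulEquiv with
    continuous_toFun := continuous_matrixProd n R S
    continuous_invFun := continuous_matrixProd_symm n R S }

/-- (Ported verbatim from the HodgeCMPerL package; no docstring in the source.) -/
@[simp] theorem coe_matrixProdCME : ⇑(matrixProdCME n R S) = matrixProd n R S := rfl

/-- (Ported verbatim from the HodgeCMPerL package; no docstring in the source.) -/
@[simp] theorem coe_matrixProdCME_symm : ⇑(matrixProdCME n R S).symm = (matrixProd n R S).symm := rfl

end MatrixProd

/-! ## §2 Units of a product of topological monoids, `GL_n(R × S)` -/

section Units

variable (A B : Type*) [Monoid A] [TopologicalSpace A] [Monoid B] [TopologicalSpace B]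

/-- `(A × B)ˣ ≃ₜ* Aˣ × Bˣ` (Mathlib's `MulEquiv.prodUnits` / `Homeomorph.prodUnits`, bundled together). -/
def prodUnitsCME : (A × B)ˣ ≃ₜ* Aˣ × Bˣ :=
  { MulEquiv.prodUnits with
    continuous_toFun := (Homeomorph.prodUnits (α := A) (β := B)).continuous
    continuous_invFun := (Homeomorph.prodUnits (α := A) (β := B)).symm.continuous }

/-- (Ported verbatim from the HodgeCMPerL package; no docstring in the source.) -/
@[simp] theorem val_prodUnitsCME_fst (u : (A × B)ˣ) : ((prodUnitsCME A B u).1 : A) = (u : A × B).1 := rfl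

/-- (Ported verbatim from the HodgeCMPerL package; no docstring in the source.) -/
@[simp] theorem val_prodUnitsCME_snd (u : (A × B)ˣ) : ((prodUnitsCME A B u).2 : B) = (u : A × B).2 := rfl

/-- (Ported verbatim from the HodgeCMPerL package; no docstring in the source.) -/
@[simp] theorem val_prodUnitsCME_symm (p : Aˣ × Bˣ) :
    ((prodUnitsCME A B).symm p : A × B) = ((p.1 : A), (p.2 : B)) := rfl

end Units

/-! ## §3a Component matrices of twisted products -/

section Componentwise

variable {n : Type*} {R S : Type*} [NonAssocSemiring R] [NonAssocSemiring S]
variable {σ : R × S →+* R × S} {σ₁ : R →+* R} {σ₂ : S →+* S}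

/-- (Ported verbatim from the HodgeCMPerL package; no docstring in the source.) -/
theorem map_map_fst_of_componentwise (h₁ : ∀ a, (σ a).1 = σ₁ a.1) (X : Matrix n n (R × S)) :
    (X.map σ).map Prod.fst = (X.map Prod.fst).map σ₁ := by
  ext i j
  exact h₁ (X i j)

/-- (Ported verbatim from the HodgeCMPerL package; no docstring in the source.) -/
theorem map_map_snd_of_componentwise (h₂ : ∀ a, (σ a).2 = σ₂ a.2) (X : Matrix n n (R × S)) :
    (X.map σ).map Prod.snd = (X.map Prod.snd).map σ₂ := by
  ext i j
  exact h₂ (X i j)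

variable [Fintype n]

/-- Components of a `σ`-twisted product `Xᵀ·Y·Z` (first factor). -/
theorem map_fst_transpose_mul_mul (X Y Z : Matrix n n (R × S)) :
    (Xᵀ * Y * Z).map Prod.fst = (X.map Prod.fst)ᵀ * Y.map Prod.fst * Z.map Prod.fst := by
  change (Xᵀ * Y * Z).map (RingHom.fst R S) = (X.map (RingHom.fst R S))ᵀ * Y.map (RingHom.fst R S) * Z.map (RingHom.fst R S)
  rw [Matrix.map_mul, Matrix.map_mul, Matrix.transpose_map]

/-- Components of a `σ`-twisted product `Xᵀ·Y·Z` (second factor). -/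
theorem map_snd_transpose_mul_mul (X Y Z : Matrix n n (R × S)) :
    (Xᵀ * Y * Z).map Prod.snd = (X.map Prod.snd)ᵀ * Y.map Prod.snd * Z.map Prod.snd := by
  change (Xᵀ * Y * Z).map (RingHom.snd R S) = (X.map (RingHom.snd R S))ᵀ * Y.map (RingHom.snd R S) * Z.map (RingHom.snd R S)
  rw [Matrix.map_mul, Matrix.map_mul, Matrix.transpose_map]

end Componentwise

section GLn

variable (n : Type*) [Fintype n] [DecidableEq n] (R S : Type*) [CommRing R] [CommRing S]
  [TopologicalSpace R] [TopologicalSpace S]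

/-- **`GL_n(R × S) ≃ₜ* GL_n(R) × GL_n(S)`** as topological groups. -/
noncomputable def glProdEquiv : GL n (R × S) ≃ₜ* GL n R × GL n S :=
  (Units.mapContinuousMulEquiv (matrixProdCME n R S)).trans (prodUnitsCME (Matrix n n R) (Matrix n n S))

/-- (Ported verbatim from the HodgeCMPerL package; no docstring in the source.) -/
@[simp] theorem val_glProdEquiv_fst (g : GL n (R × S)) :
    ((glProdEquiv n R S g).1 : Matrix n n R) = (g : Matrix n n (R × S)).map Prod.fst := rfl

/-- (Ported verbatim from the HodgeCMPerL package; no docstring in the source.) -/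
@[simp] theorem val_glProdEquiv_snd (g : GL n (R × S)) :
    ((glProdEquiv n R S g).2 : Matrix n n S) = (g : Matrix n n (R × S)).map Prod.snd := rfl

/-- (Ported verbatim from the HodgeCMPerL package; no docstring in the source.) -/
@[simp] theorem val_glProdEquiv_symm_apply (p : GL n R × GL n S) (i j : n) :
    ((glProdEquiv n R S).symm p : Matrix n n (R × S)) i j = ((p.1 : Matrix n n R) i j, (p.2 : Matrix n n S) i j) :=
  rfl

/-! ## §3 Unitary groups of a componentwise conjugation -/

variable {n R S}
variable {σ : R × S →+* R × S} {σ₁ : R →+* R} {σ₂ : S →+* S}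

/-- **The unitary relation splits componentwise**: for `σ` acting through `σ₁ × σ₂`,
`(σ g)ᵀ H g = H` in `M_n(R × S)` iff the same holds for both components. -/
theorem mem_unitaryGroup_prod_iff (h₁ : ∀ a, (σ a).1 = σ₁ a.1) (h₂ : ∀ a, (σ a).2 = σ₂ a.2)
    (H : Matrix n n (R × S)) (g : GL n (R × S)) :
    g ∈ unitaryGroup σ H ↔
      (glProdEquiv n R S g).1 ∈ unitaryGroup σ₁ (H.map Prod.fst) ∧
        (glProdEquiv n R S g).2 ∈ unitaryGroup σ₂ (H.map Prod.snd) := by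
  rw [Literature.AlgebraicGeometry.ShimuraVarieties.mem_unitaryGroup_iff,
    Literature.AlgebraicGeometry.ShimuraVarieties.mem_unitaryGroup_iff,
    Literature.AlgebraicGeometry.ShimuraVarieties.mem_unitaryGroup_iff, val_glProdEquiv_fst, val_glProdEquiv_snd,
    ext_iff_map_fst_snd n R S, map_fst_transpose_mul_mul, map_snd_transpose_mul_mul,
    map_map_fst_of_componentwise h₁, map_map_snd_of_componentwise h₂]

/-- (Ported verbatim from the HodgeCMPerL package; no docstring in the source.) -/
theorem fst_mem_unitaryGroup (h₁ : ∀ a, (σ a).1 = σ₁ a.1) (h₂ : ∀ a, (σ a).2 = σ₂ a.2)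
    (H : Matrix n n (R × S)) (u : unitaryGroup σ H) :
    (glProdEquiv n R S u).1 ∈ unitaryGroup σ₁ (H.map Prod.fst) :=
  ((mem_unitaryGroup_prod_iff h₁ h₂ H u).1 u.2).1

/-- (Ported verbatim from the HodgeCMPerL package; no docstring in the source.) -/
theorem snd_mem_unitaryGroup (h₁ : ∀ a, (σ a).1 = σ₁ a.1) (h₂ : ∀ a, (σ a).2 = σ₂ a.2)
    (H : Matrix n n (R × S)) (u : unitaryGroup σ H) :
    (glProdEquiv n R S u).2 ∈ unitaryGroup σ₂ (H.map Prod.snd) :=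
  ((mem_unitaryGroup_prod_iff h₁ h₂ H u).1 u.2).2

/-- (Ported verbatim from the HodgeCMPerL package; no docstring in the source.) -/
theorem symm_mem_unitaryGroup (h₁ : ∀ a, (σ a).1 = σ₁ a.1) (h₂ : ∀ a, (σ a).2 = σ₂ a.2)
    (H : Matrix n n (R × S)) (p : unitaryGroup σ₁ (H.map Prod.fst) × unitaryGroup σ₂ (H.map Prod.snd)) :
    (glProdEquiv n R S).symm ((p.1 : GL n R), (p.2 : GL n S)) ∈ unitaryGroup σ H := by
  rw [mem_unitaryGroup_prod_iff h₁ h₂ H, ContinuousMulEquiv.apply_symm_apply]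
  exact ⟨p.1.2, p.2.2⟩

/-- The forward map of `unitaryProdEquiv`. -/
noncomputable def unitaryProdFun (h₁ : ∀ a, (σ a).1 = σ₁ a.1) (h₂ : ∀ a, (σ a).2 = σ₂ a.2)
    (H : Matrix n n (R × S)) :
    unitaryGroup σ H → unitaryGroup σ₁ (H.map Prod.fst) × unitaryGroup σ₂ (H.map Prod.snd) :=
  fun u => (⟨(glProdEquiv n R S u).1, fst_mem_unitaryGroup h₁ h₂ H u⟩,
    ⟨(glProdEquiv n R S u).2, snd_mem_unitaryGroup h₁ h₂ H u⟩)

/-- The inverse map of `unitaryProdEquiv`. -/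
noncomputable def unitaryProdInv (h₁ : ∀ a, (σ a).1 = σ₁ a.1) (h₂ : ∀ a, (σ a).2 = σ₂ a.2)
    (H : Matrix n n (R × S)) :
    unitaryGroup σ₁ (H.map Prod.fst) × unitaryGroup σ₂ (H.map Prod.snd) → unitaryGroup σ H :=
  fun p => ⟨(glProdEquiv n R S).symm ((p.1 : GL n R), (p.2 : GL n S)), symm_mem_unitaryGroup h₁ h₂ H p⟩

/-- (Ported verbatim from the HodgeCMPerL package; no docstring in the source.) -/
theorem continuous_unitaryProdFun (h₁ : ∀ a, (σ a).1 = σ₁ a.1) (h₂ : ∀ a, (σ a).2 = σ₂ a.2)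
    (H : Matrix n n (R × S)) : Continuous (unitaryProdFun h₁ h₂ H) :=
  (((glProdEquiv n R S).continuous.comp continuous_subtype_val).fst.subtype_mk _).prodMk
    (((glProdEquiv n R S).continuous.comp continuous_subtype_val).snd.subtype_mk _)

/-- (Ported verbatim from the HodgeCMPerL package; no docstring in the source.) -/
theorem continuous_unitaryProdInv (h₁ : ∀ a, (σ a).1 = σ₁ a.1) (h₂ : ∀ a, (σ a).2 = σ₂ a.2)
    (H : Matrix n n (R × S)) : Continuous (unitaryProdInv h₁ h₂ H) :=
  ((glProdEquiv n R S).symm.continuous.comp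
    ((continuous_subtype_val.comp continuous_fst).prodMk (continuous_subtype_val.comp continuous_snd))).subtype_mk _

/-- **`U_σ(H) ≃ₜ* U_{σ₁}(H₁) × U_{σ₂}(H₂)`** for a componentwise conjugation: the restriction of `glProdEquiv`. -/
noncomputable def unitaryProdEquiv (h₁ : ∀ a, (σ a).1 = σ₁ a.1) (h₂ : ∀ a, (σ a).2 = σ₂ a.2)
    (H : Matrix n n (R × S)) :
    unitaryGroup σ H ≃ₜ* unitaryGroup σ₁ (H.map Prod.fst) × unitaryGroup σ₂ (H.map Prod.snd) :=
  { toFun := unitaryProdFun h₁ h₂ H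
    invFun := unitaryProdInv h₁ h₂ H
    left_inv := fun u => Subtype.ext ((glProdEquiv n R S).symm_apply_apply (u : GL n (R × S)))
    right_inv := fun p =>
      Prod.ext
        (Subtype.ext (congrArg Prod.fst ((glProdEquiv n R S).apply_symm_apply ((p.1 : GL n R), (p.2 : GL n S)))))
        (Subtype.ext (congrArg Prod.snd ((glProdEquiv n R S).apply_symm_apply ((p.1 : GL n R), (p.2 : GL n S)))))
    map_mul' := fun u v =>
      Prod.ext (Subtype.ext (congrArg Prod.fst (map_mul (glProdEquiv n R S) (u : GL n (R × S)) (v : GL n (R × S)))))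
        (Subtype.ext (congrArg Prod.snd (map_mul (glProdEquiv n R S) (u : GL n (R × S)) (v : GL n (R × S)))))
    continuous_toFun := continuous_unitaryProdFun h₁ h₂ H
    continuous_invFun := continuous_unitaryProdInv h₁ h₂ H }

/-- (Ported verbatim from the HodgeCMPerL package; no docstring in the source.) -/
@[simp] theorem val_unitaryProdEquiv_fst (h₁ : ∀ a, (σ a).1 = σ₁ a.1) (h₂ : ∀ a, (σ a).2 = σ₂ a.2)
    (H : Matrix n n (R × S)) (u : unitaryGroup σ H) :
    ((unitaryProdEquiv h₁ h₂ H u).1 : GL n R) = (glProdEquiv n R S u).1 := rfl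

/-- (Ported verbatim from the HodgeCMPerL package; no docstring in the source.) -/
@[simp] theorem val_unitaryProdEquiv_snd (h₁ : ∀ a, (σ a).1 = σ₁ a.1) (h₂ : ∀ a, (σ a).2 = σ₂ a.2)
    (H : Matrix n n (R × S)) (u : unitaryGroup σ H) :
    ((unitaryProdEquiv h₁ h₂ H u).2 : GL n S) = (glProdEquiv n R S u).2 := rfl

/-- (Ported verbatim from the HodgeCMPerL package; no docstring in the source.) -/
@[simp] theorem val_unitaryProdEquiv_symm_apply (h₁ : ∀ a, (σ a).1 = σ₁ a.1) (h₂ : ∀ a, (σ a).2 = σ₂ a.2)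
    (H : Matrix n n (R × S)) (p : unitaryGroup σ₁ (H.map Prod.fst) × unitaryGroup σ₂ (H.map Prod.snd)) :
    (((unitaryProdEquiv h₁ h₂ H).symm p : unitaryGroup σ H) : GL n (R × S)) =
      (glProdEquiv n R S).symm ((p.1 : GL n R), (p.2 : GL n S)) := rfl

end GLn

/-! ## §4 Commuting factors -/

section Commute

variable {G A B : Type*} [Group G] [Monoid A] [Monoid B]

/-- In a group identified with a product `A × B`, an element with trivial `A`-component commutes with an
element with trivial `B`-component. -/
theorem commute_of_prod_decomp {F : Type*} [EquivLike F G (A × B)] [MulEquivClass F G (A × B)] (e : F)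
    {x y : G} (hx : (e x).1 = 1) (hy : (e y).2 = 1) : x * y = y * x := by
  apply (EquivLike.injective e)
  rw [map_mul, map_mul, Prod.ext_iff]
  constructor
  · rw [Prod.fst_mul, Prod.fst_mul, hx, one_mul, mul_one]
  · rw [Prod.snd_mul, Prod.snd_mul, hy, one_mul, mul_one]

end Commute

end HodgeCM.PerL34.GLProd
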